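import Mathlib.LinearAlgebra.Matrix.Trace
import Mathlib.Data.ZMod.Basic
import Mathlib.Algebra.CharP.Two
import Mathlib.Algebra.BigOperators.Ring.Finset

/-!
# Crux `CubicForrelation.NearExactIsExact` (stmt-QuantumAdvantage-14043) — n = 12, E1280-even, rank-2 half:
  the PAIRING-PARTNER criterion kills descendant `0` by a trace identity

Certificate seat `b2b-cforr-cert` (gen 37).  HONEST FRAMING: a kernel-checked piece of elementary linear algebra over `𝔽₂` that is one
leaf of the computer-assisted case analysis of the last open case ("E1280-even") of the 12-bit window `(57/64, 29/32)`; by itself it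
excludes nothing about `θ₁₂` and is NOT summit progress.

Context (HOME/b2b-cforr-cert-g37/R2-PARTNER.md).  If the cubic part `d` of a light digit class is a matching dual `C*`, the pairing
lemma (…TwelveDigitPairing) provides a PARTNER `c` with `Σ_{j<k} c_{pjk} d_{φjk} = [p = φ]`.  In the rank-2 frame
`d = y₁y₂y₃ + y₂∧Γ₂ + y₃∧Γ₁ + t̄` the equations with `p, φ` among the nine cell coordinates read `Γ₂·A + Γ₁·B + τ = 1` for the
alternating `9 × 9` matrices `A = (c_{2kx})`, `B = (c_{3kx})` and a correction `τ` supported on the slices of the descendant `t̄`.  For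
descendant `t̄ = 0` there is no correction, and the identity below (`tpc_trace_mul_alternating`: the trace of a product of two alternating
matrices over `𝔽₂` vanishes) gives `0 = tr 1 = 9 = 1` — `tpc_descendant_zero_obstruction`.  (g36 used the descendant-pairing lemma
here; the partner equations alone suffice.)

References: this work (cert seats g33–g37); MacWilliams–Sloane (1977) Ch. 15 for alternating forms over `𝔽₂`.  Axioms: the standard three.
-/

set_option linter.dupNamespace false -- D-0017: single-problem summit ⇒ `QuantumAdvantage.QuantumAdvantage` by design

namespace Summit.QuantumAdvantage.QuantumAdvantage.Theorems.CubicForrelation.NearExactIsExact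

open Finset Matrix

/-- **Trace of a product of two alternating matrices over `𝔽₂` vanishes.**  If `P` and `Q` are symmetric with zero diagonal
(= alternating in characteristic `2`) then `tr (P Q) = Σ_{i,j} P_{ij} Q_{ji} = 0`: the `(i,j)` and `(j,i)` terms coincide and the
diagonal terms vanish. [this work] -/
theorem tpc_trace_mul_alternating {n : ℕ} (P Q : Matrix (Fin n) (Fin n) (ZMod 2))
    (hPd : ∀ i, P i i = 0) (hPs : Pᵀ = P) (hQs : Qᵀ = Q) : (P * Q).trace = 0 := by
  have hsym : ∀ i j, P j i = P i j := fun i j => by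
    simpa [Matrix.transpose_apply] using congrFun (congrFun hPs i) j
  have hsymQ : ∀ i j, Q j i = Q i j := fun i j => by
    simpa [Matrix.transpose_apply] using congrFun (congrFun hQs i) j
  simp only [Matrix.trace, Matrix.diag_apply, Matrix.mul_apply]
  rw [← Finset.sum_product' (s := univ) (t := univ) (f := fun i j => P i j * Q j i)]
  refine Finset.sum_involution (fun p _ => (p.2, p.1)) ?_ ?_ ?_ ?_
  · intro p _
    rw [hsym p.1 p.2, hsymQ p.2 p.1]
    exact CharTwo.add_self_eq_zero _
  · rintro ⟨i, j⟩ _ hne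
    simp only [ne_eq, Prod.mk.injEq, not_and]
    intro hji
    subst hji
    exact absurd (by rw [hPd]; simp) hne
  · intro p _
    exact mem_product.mpr ⟨mem_univ _, mem_univ _⟩
  · intro p _
    rfl

/-- **Descendant `0` is impossible (partner criterion).**  For alternating `9 × 9` matrices `G, A, Γ, B` over `𝔽₂`
(symmetric, zero diagonal) the identity `G A + Γ B = 1` is impossible — take traces: `0 + 0 = 9 = 1`.  In the rank-2 frame of a
light digit class whose cubic part has a pairing partner this is exactly the system of pairing equations on the nine cell coordinates when
the descendant vanishes. [this work] -/
theorem tpc_descendant_zero_obstruction (G A Γ B : Matrix (Fin 9) (Fin 9) (ZMod 2))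
    (hGd : ∀ i, G i i = 0) (hGs : Gᵀ = G) (hAs : Aᵀ = A)
    (hΓd : ∀ i, Γ i i = 0) (hΓs : Γᵀ = Γ) (hBs : Bᵀ = B) :
    G * A + Γ * B ≠ 1 := by
  intro h
  have ht := congrArg Matrix.trace h
  rw [Matrix.trace_add, tpc_trace_mul_alternating G A hGd hGs hAs, tpc_trace_mul_alternating Γ B hΓd hΓs hBs,
    Matrix.trace_one, Fintype.card_fin] at ht
  revert ht
  decide

/-- The same obstruction for any ODD number of cell coordinates (the frame dimension `12 − 3 = 9` is odd). [this work] -/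
theorem tpc_alternating_partner_obstruction_odd {n : ℕ} (hn : Odd n) (G A Γ B : Matrix (Fin n) (Fin n) (ZMod 2))
    (hGd : ∀ i, G i i = 0) (hGs : Gᵀ = G) (hAs : Aᵀ = A)
    (hΓd : ∀ i, Γ i i = 0) (hΓs : Γᵀ = Γ) (hBs : Bᵀ = B) :
    G * A + Γ * B ≠ 1 := by
  intro h
  have ht := congrArg Matrix.trace h
  rw [Matrix.trace_add, tpc_trace_mul_alternating G A hGd hGs hAs, tpc_trace_mul_alternating Γ B hΓd hΓs hBs,
    Matrix.trace_one, Fintype.card_fin] at ht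
  have h2 : ((n : ℕ) : ZMod 2) = 1 := by
    obtain ⟨k, rfl⟩ := hn
    push_cast
    rw [show (2 : ZMod 2) = 0 from rfl]
    simp
  rw [h2] at ht
  exact zero_ne_one ht

end Summit.QuantumAdvantage.QuantumAdvantage.Theorems.CubicForrelation.NearExactIsExact
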